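import Literature.MathematicalPhysics.QuantumFieldTheory.CentreDominatedTwistSectors
import Literature.MathematicalPhysics.QuantumLattice.TwistedSectorClassicalRate
import HarnessLib

/-!
# Centre domination of 't Hooft's twist sectors `W{n_{μν}}` (all planes at once): the `SU(2)`
# sector ratios `W{n}/W{0}` at `β` dominate the `ℤ₂` sector ratios at `2β`

Theorem-only bridge (topic `Literature/MathematicalPhysics/QuantumFieldTheory`; two small plumbing
definitions, no named facts) between the tree's centre-domination theorem for central insertions on
an arbitrary plaquette set,
`Literature.MathematicalPhysics.QuantumFieldTheory.insertedPartitionFunction_centre_ratio_le`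
(`CentreDominatedTwistSectors.lean`: `Z_{ℤ₂,Nβ}(S)/Z_{ℤ₂,Nβ} ≤ Z_{G,β}(S)/Z_{G,β}`), and the
multi-plane 't Hooft twist vocabulary of `QuantumLattice/TwistedBoundaryConditions.lean`
(`Twist d G = Plane d → Z(G)`, `plaquetteTwist`, `twistOfTensor N n`, `suCenter`) and
`QuantumLattice/TwistedSectorClassicalRate.lean` (`TwistedSector.twistZ ρ z β L` = 't Hooft's
`W{n_{μν}; a_μ}` on the symmetric torus `(ℤ/L)^d`, Nucl. Phys. B153 (1979) 141 §2 (2.5)–(2.6)), in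
which the tree's electric-flux files (`THooftElectricFlux*`, `ElectricFluxPositivity`,
`TwistedPartitionFunctionMonotone`: `Z_z ≤ Z_1`) are written.

## What is proved

* `twistOfInvolution z₀ hzc m` — the twist with `z_{μν} = z₀` on the planes where the `ℤ₂` tensor
  `m : Plane d → ZMod 2` is `1` and `z_{μν} = 1` elsewhere (every twist of a group whose centre
  element in use is an involution: `SU(2)`, and `-𝟙 ∈ SU(2m)`); `z2TwistOfTensor m` — the same
  tensor read in `ℤ₂`; `plaquetteTwist_twistOfInvolution_inv` — its inserted field
  `p ↦ (z_p)⁻¹` is the tree's `centreInsertion z₀ (twistSet m)`;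
* ★ `twistZ_ratio_ge_centre` — compact `G`, continuous unitary `ρ` on `ℂ^N`, central involution
  `z₀` with `ρ(z₀) = -1`, `β ≥ 0`, `L ≥ 2`, any tensor `m`:
  `twistZ z2Rep (z2TwistOfTensor m) (Nβ) L / twistZ z2Rep 1 (Nβ) L ≤
   twistZ ρ (twistOfInvolution z₀ m) β L / twistZ ρ 1 β L`;
* `twistOfTensor_two_eq_twistOfInvolution` — for `SU(2)`, 't Hooft's `twistOfTensor 2 n` IS
  `twistOfInvolution (-𝟙) n`; hence ★ `su2_twistZ_ratio_ge_z2`: for EVERY twist tensor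
  `n : Plane d → ZMod 2` (all `2^{d(d-1)/2}` sectors, electric and magnetic at once),
  `W^{ℤ₂}_{2β}{n}/W^{ℤ₂}_{2β}{0} ≤ W^{SU(2)}_{β}{n}/W^{SU(2)}_{β}{0}` —
  **every 't Hooft sector of `SU(2)` at `β` is at least as heavy, relative to the periodic sector,
  as the same sector of `ℤ₂` lattice gauge theory at `2β`** (the flux free energies
  `-log(W{n}/W{0})` of `SU(2)` are bounded ABOVE by those of `ℤ₂` at `2β`);
* §4 `SU(N)`, `N` even (`-𝟙 = suCenter N (N/2)`, `suCenter_half_eq_negOneSU`): for the `ℤ₂ ⊆ ℤ_N`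
  sectors `n = (N/2)·m` (`halfTensor N m`), `specialUnitaryGroup_twistZ_ratio_ge_z2_of_even`:
  `W^{ℤ₂}_{Nβ}{m}/W^{ℤ₂}_{Nβ}{0} ≤ W^{SU(N)}_{β}{(N/2)·m}/W^{SU(N)}_{β}{0}` (the sectors
  `n_{μν} ∉ {0, N/2}` are NOT covered: no `ℤ_N` analogue of the flip lemma is proved).

HONEST LABEL: elementary consequence of Fröhlich's decomposition [Grosse1988 (4.130)–(4.134)] and
Griffiths' comparison [FriedliVelenik2017 Thm 3.49] (tree `CentreDominatedTwistSectors.lean`), not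
located in print as a theorem; content at strong coupling only (`ℤ₂` at `2β` deconfines at weak
coupling in `d = 4`); finite-volume lattice partition functions; nothing here bears on the mass gap
or the infrared problem; the Yang–Mills mass gap (Clay) is NOT proved; the cell's route R4 closes
only the conditional finite-`𝕋⁴` rung `BalabanLadder.UV`.

## References

* G. 't Hooft, Nucl. Phys. B153 (1979) 141–160, §2 (2.5)–(2.6). [tHooft1979Flux]
* H. Grosse, *Models in Statistical Physics and Quantum Field Theory* (Springer 1988), §4.2.4
  (4.129)–(4.134). [Grosse1988]
* M. García Pérez, A. González-Arroyo, M. Okawa, arXiv:1406.5655, §6 (corner plaquettes).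
  [GarciaperezGonzalezarroyoOkawa2014]
-/

noncomputable section

open MeasureTheory Finset
open Literature.MathematicalPhysics.QuantumLattice
open Literature.MathematicalPhysics.QuantumLattice.TwistedSector

namespace Literature.MathematicalPhysics.QuantumFieldTheory

/-! ### §1 Involution-valued twists and their inserted fields -/

section Involution

variable {d L : ℕ} {G : Type*} [Group G]

/-- The 't Hooft twist with `z_{μν} = z₀` on the planes `{m = 1}` and `z_{μν} = 1` elsewhere, for a
central `z₀` and a `ℤ₂`-valued tensor `m : Plane d → ZMod 2` ('t Hooft's `n_{μν}` for a centre
`ℤ₂`, (2.5)). [cite: tHooft1979Flux, §2 eq. (2.5)] -/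
def twistOfInvolution (z₀ : G) (hzc : z₀ ∈ Subgroup.center G) (m : Plane d → ZMod 2) : Twist d G :=
  fun q => if m q = 1 then ⟨z₀, hzc⟩ else 1

/-- The same tensor read in the gauge group `ℤ₂ = Multiplicative (ZMod 2)` (its own centre):
`z_{μν} = ofAdd (m_{μν})`. [cite: tHooft1979Flux, §2 eq. (2.5)] -/
def z2TwistOfTensor (m : Plane d → ZMod 2) : Twist d (Multiplicative (ZMod 2)) :=
  twistOfInvolution (Multiplicative.ofAdd (1 : ZMod 2)) (Subgroup.mem_center_iff.2 fun g => mul_comm g _) m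

/-- The plaquettes carrying the twist: the corner plaquettes of the planes `{m = 1}`
(García Pérez–González-Arroyo–Okawa §6: «`z_{μν}(n)` is equal to 1 except for the corner
plaquettes in each plane»). [cite: GarciaperezGonzalezarroyoOkawa2014, §6] -/
def twistSet [NeZero L] (m : Plane d → ZMod 2) : Finset (Plaquette d L) :=
  univ.filter fun p => IsCornerPlaquette p ∧ m p.2 = 1

/-- **The inserted field of an involution-valued twist is a central insertion on a plaquette set**:
`(z_p)⁻¹ = centreInsertion z₀ (twistSet m) p` for `z = twistOfInvolution z₀ m`, `z₀² = 1`.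
[cite: GarciaperezGonzalezarroyoOkawa2014, §6] -/
theorem plaquetteTwist_twistOfInvolution_inv [NeZero L] {z₀ : G} (hzc : z₀ ∈ Subgroup.center G)
    (hz2 : z₀ * z₀ = 1) (m : Plane d → ZMod 2) :
    (fun p : Plaquette d L => (plaquetteTwist (twistOfInvolution z₀ hzc m) p)⁻¹) =
      centreInsertion z₀ (twistSet m) := by
  have hinv : z₀⁻¹ = z₀ := inv_eq_of_mul_eq_one_right hz2
  funext p
  simp only [plaquetteTwist, twistOfInvolution, centreInsertion, twistSet, Finset.mem_filter,
    Finset.mem_univ, true_and]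
  by_cases hc : IsCornerPlaquette p
  · by_cases hm : m p.2 = 1
    · simp [hc, hm, hinv]
    · simp [hc, hm]
  · simp [hc]

/-- With the zero tensor the twist is trivial (periodic boundary conditions).
[cite: tHooft1979Flux, §2 eq. (2.5)] -/
@[simp] theorem twistOfInvolution_zero {z₀ : G} (hzc : z₀ ∈ Subgroup.center G) :
    twistOfInvolution (d := d) z₀ hzc 0 = 1 := by
  funext q
  simp [twistOfInvolution]

end Involution

/-! ### §2 Centre domination of the twist sectors `twistZ` -/

section Sectors

variable {d L N : ℕ} [NeZero L] [Fact (1 < L)] {G : Type*} [Group G] [TopologicalSpace G]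
  [IsTopologicalGroup G] [CompactSpace G] [MeasurableSpace G] [BorelSpace G]
  (ρ : G →* Matrix (Fin N) (Fin N) ℂ)

/-- ★ **Centre domination of 't Hooft's twist sectors.** Compact `G`, continuous unitary `ρ` on
`ℂ^N`, central involution `z₀` with `ρ(z₀) = -1`, `β ≥ 0`, torus side `L ≥ 2`, any tensor
`m : Plane d → ZMod 2`:
`Z^{ℤ₂}_{Nβ}(m)/Z^{ℤ₂}_{Nβ}(0) ≤ Z^{G}_{β}(z₀^m)/Z^{G}_{β}(1)` — the sector `z₀^m` of the
`G`-theory (twist `z₀` through the planes `{m = 1}`) is, relative to the periodic sector, at least as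
heavy as the same sector of `ℤ₂` lattice gauge theory at `Nβ` ('t Hooft's `W{n_{μν}}`, (2.6); the
tree's `insertedPartitionFunction_centre_ratio_le` read through `TwistedSector.twistZ`).
HONEST LABEL: content at strong coupling only. [cite: tHooft1979Flux, §2 eqs. (2.5)–(2.6)] [cite: Grosse1988, §4.2.4 eqs. (4.130)–(4.134)] -/
theorem twistZ_ratio_ge_centre (hρ : Continuous ρ) (hρu : ∀ g, ρ g ∈ Matrix.unitaryGroup (Fin N) ℂ)
    {z₀ : G} (hzc : z₀ ∈ Subgroup.center G) (hz2 : z₀ * z₀ = 1) (hρz : ρ z₀ = -1) {β : ℝ}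
    (hβ : 0 ≤ β) (m : Plane d → ZMod 2) :
    twistZ z2Rep (z2TwistOfTensor m) ((N : ℝ) * β) L /
        twistZ z2Rep (1 : Twist d (Multiplicative (ZMod 2))) ((N : ℝ) * β) L ≤
      twistZ ρ (twistOfInvolution z₀ hzc m) β L / twistZ ρ (1 : Twist d G) β L := by
  unfold twistZ
  rw [z2TwistOfTensor, plaquetteTwist_twistOfInvolution_inv hzc hz2 m,
    plaquetteTwist_twistOfInvolution_inv _ (by decide) m]
  simp only [plaquetteTwist_one, inv_one]
  rw [z2_insertedPartitionFunction_ratio_eq]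
  exact insertedPartitionFunction_centre_ratio_le ρ hρ hρu hzc hz2 hρz hβ _

end Sectors

/-! ### §3 `SU(2)`: all of 't Hooft's sectors `W{n}` at once (coupling `2β`) -/

section SU2

open Tomboulis2007

variable {d L : ℕ} [NeZero L] [Fact (1 < L)]

/-- `ω = e^{2πi·1/2} = -1`. [folklore] -/
private theorem centerPhase_two_one' : centerPhase 2 1 = -1 := by
  rw [centerPhase]
  have : (2 * Real.pi * (((1 : ZMod 2).val : ℕ) : ℝ) / ((2 : ℕ) : ℝ) : ℝ) = Real.pi := by
    rw [show (1 : ZMod 2).val = 1 from rfl]; push_cast; ring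
  rw [this, Complex.exp_pi_mul_I]

/-- The non-trivial centre element of `SU(2)`: `suCenter 2 1 = -𝟙` (the tree's `negOne`).
[cite: tHooft1979Flux, §2 (2.2)] -/
theorem suCenter_two_one_eq_negOne :
    (suCenter 2 1 : Matrix.specialUnitaryGroup (Fin 2) ℂ) = negOne := by
  apply Subtype.ext
  rw [coe_suCenter, centerPhase_two_one', neg_smul, one_smul]
  rfl

/-- The trivial centre element of `SU(2)`: `suCenter 2 0 = 𝟙` (label `0` of 't Hooft's `Z_N`, (2.2)).
[cite: tHooft1979Flux, §2 (2.2)] -/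
theorem suCenter_two_zero : (suCenter 2 0 : Matrix.specialUnitaryGroup (Fin 2) ℂ) = 1 := by
  apply Subtype.ext
  rw [coe_suCenter]
  simp [centerPhase]

/-- For `SU(2)`, 't Hooft's twist of a tensor `n : Plane d → ZMod 2` is the involution twist of `-𝟙`
on the planes `{n = 1}`. [cite: tHooft1979Flux, §2 eqs. (2.2), (2.5)] -/
theorem twistOfTensor_two_eq_twistOfInvolution (n : Plane d → ZMod 2) :
    twistOfTensor 2 n =
      twistOfInvolution (d := d) negOne (Subgroup.mem_center_iff.2 fun g => (negOne_mul_comm g).symm) n := by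
  funext q
  apply Subtype.ext
  rcases (by decide : ∀ a : ZMod 2, a = 0 ∨ a = 1) (n q) with h | h
  · have h01 : (0 : ZMod 2) ≠ 1 := by decide
    simp only [twistOfTensor, twistOfInvolution, h, h01, if_false]
    exact suCenter_two_zero
  · simp only [twistOfTensor, twistOfInvolution, h, if_true]
    exact suCenter_two_one_eq_negOne

/-- ★ **`SU(2)`: every 't Hooft sector at `β` dominates the same `ℤ₂` sector at `2β`.** For the
fundamental representation and EVERY twist tensor `n : Plane d → ZMod 2` (all electric and magnetic
twists at once), `β ≥ 0`, any torus side `L ≥ 2`: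
`W^{ℤ₂}_{2β,L}{n} / W^{ℤ₂}_{2β,L}{0} ≤ W^{SU(2)}_{β,L}{n} / W^{SU(2)}_{β,L}{0}`
(`W{n}` = `TwistedSector.twistZ`, 't Hooft (2.6)): the flux free energies `-log(W{n}/W{0})` of `SU(2)`
are bounded above by those of `ℤ₂` lattice gauge theory at `2β` (dual companion of Grosse's (4.134),
`|⟨W_C⟩_{SU(2),β}| ≤ ⟨W_C⟩_{ℤ₂,2β}`). HONEST LABEL: content at strong coupling only; nothing about the
mass gap. [cite: tHooft1979Flux, §2 eqs. (2.5)–(2.6)] [cite: Grosse1988, §4.2.4 eq. (4.134)] -/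
theorem su2_twistZ_ratio_ge_z2 {β : ℝ} (hβ : 0 ≤ β) (n : Plane d → ZMod 2) :
    twistZ z2Rep (z2TwistOfTensor n) (2 * β) L /
        twistZ z2Rep (1 : Twist d (Multiplicative (ZMod 2))) (2 * β) L ≤
      twistZ (fundamentalRep (Fin 2)) (twistOfTensor 2 n) β L /
        twistZ (fundamentalRep (Fin 2)) (1 : Twist d (Matrix.specialUnitaryGroup (Fin 2) ℂ)) β L := by
  rw [twistOfTensor_two_eq_twistOfInvolution]
  have h := twistZ_ratio_ge_centre (d := d) (L := L) (fundamentalRep (Fin 2))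
    (continuous_fundamentalRep (Fin 2)) (fun g => (Matrix.mem_specialUnitaryGroup_iff.1 g.2).1)
    (z₀ := negOne) (Subgroup.mem_center_iff.2 fun g => (negOne_mul_comm g).symm) negOne_mul_negOne
    (by rw [fundamentalRep_apply]; rfl) hβ n
  simpa using h

end SU2

/-! ### §4 `SU(N)`, `N` even: the `ℤ₂ ⊆ ℤ_N` sectors `n_{μν} ∈ {0, N/2}` (coupling `Nβ`) -/

section SUNEven

variable {d L : ℕ} [NeZero L] [Fact (1 < L)]

/-- `ω^{N/2} = e^{iπ} = -1` for even `N ≥ 2`. [folklore] -/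
private theorem centerPhase_half {N : ℕ} [NeZero N] (hN : Even N) :
    centerPhase N (((N / 2 : ℕ) : ZMod N)) = -1 := by
  obtain ⟨k, rfl⟩ := hN
  have hk : 0 < k := by
    rcases Nat.eq_zero_or_pos k with h | h
    · exact absurd (by simp [h]) (NeZero.ne (k + k))
    · exact h
  rw [centerPhase]
  have hval : (((k + k) / 2 : ℕ) : ZMod (k + k)).val = k := by
    rw [show (k + k) / 2 = k by omega]
    exact ZMod.val_cast_of_lt (by omega)
  have : (2 * Real.pi * ((((k + k) / 2 : ℕ) : ZMod (k + k)).val : ℝ) / ((k + k : ℕ) : ℝ) : ℝ) = Real.pi := by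
    rw [hval]
    have hk' : (k : ℝ) ≠ 0 := Nat.cast_ne_zero.2 hk.ne'
    push_cast
    field_simp
    ring
  rw [this, Complex.exp_pi_mul_I]

/-- For even `N`, the centre element with label `N/2` is `-𝟙 ∈ SU(N)` (the tree's `negOneSU`).
[cite: tHooft1979Flux, §2 (2.2)] -/
theorem suCenter_half_eq_negOneSU {N : ℕ} [NeZero N] (hN : Even N) :
    (suCenter N (((N / 2 : ℕ) : ZMod N)) : Matrix.specialUnitaryGroup (Fin N) ℂ) = negOneSU N hN := by
  apply Subtype.ext
  rw [coe_suCenter, centerPhase_half hN, neg_smul, one_smul, coe_negOneSU]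

/-- The centre element with label `0` is `𝟙`. [cite: tHooft1979Flux, §2 (2.2)] -/
theorem suCenter_zero_eq_one (N : ℕ) : (suCenter N 0 : Matrix.specialUnitaryGroup (Fin N) ℂ) = 1 := by
  apply Subtype.ext
  rw [coe_suCenter]
  simp [centerPhase]

/-- The `ℤ₂`-valued 't Hooft tensors of `SU(N)`, `N` even: `n_{μν} = (N/2)·m_{μν}`, `m_{μν} ∈ {0,1}`.
[cite: tHooft1979Flux, §2 eq. (2.5)] -/
def halfTensor (N : ℕ) (m : Plane d → ZMod 2) : Plane d → ZMod N :=
  fun q => if m q = 1 then (((N / 2 : ℕ) : ZMod N)) else 0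

/-- For even `N`, 't Hooft's twist of the tensor `(N/2)·m` is the involution twist of `-𝟙` on the
planes `{m = 1}`. [cite: tHooft1979Flux, §2 eqs. (2.2), (2.5)] -/
theorem twistOfTensor_halfTensor_eq_twistOfInvolution {N : ℕ} [NeZero N] (hN : Even N)
    (m : Plane d → ZMod 2) :
    twistOfTensor N (halfTensor N m) =
      twistOfInvolution (d := d) (negOneSU N hN) (negOneSU_mem_center hN) m := by
  funext q
  apply Subtype.ext
  rcases (by decide : ∀ a : ZMod 2, a = 0 ∨ a = 1) (m q) with h | h
  · have h01 : (0 : ZMod 2) ≠ 1 := by decide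
    simp only [twistOfTensor, twistOfInvolution, halfTensor, h, h01, if_false]
    exact suCenter_zero_eq_one N
  · simp only [twistOfTensor, twistOfInvolution, halfTensor, h, if_true]
    exact suCenter_half_eq_negOneSU hN

/-- ★ **`SU(N)`, `N` even: every `ℤ₂ ⊆ ℤ_N` 't Hooft sector at `β` dominates the same `ℤ₂` sector at
`Nβ`.** For the fundamental representation of `SU(N)`, `N ≥ 2` even, every tensor
`m : Plane d → ZMod 2`, `β ≥ 0`, torus side `L ≥ 2`:
`W^{ℤ₂}_{Nβ,L}{m} / W^{ℤ₂}_{Nβ,L}{0} ≤ W^{SU(N)}_{β,L}{(N/2)·m} / W^{SU(N)}_{β,L}{0}`.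
HONEST LABEL: the other sectors `n_{μν} ∉ {0, N/2}` of `ℤ_N` are not covered (no `ℤ_N` analogue of
the flip lemma); content at strong coupling only; nothing about the mass gap.
[cite: tHooft1979Flux, §2 eqs. (2.5)–(2.6)] [cite: Grosse1988, §4.2.4 eq. (4.134)] -/
theorem specialUnitaryGroup_twistZ_ratio_ge_z2_of_even {N : ℕ} [NeZero N] (hN : Even N) {β : ℝ}
    (hβ : 0 ≤ β) (m : Plane d → ZMod 2) :
    twistZ z2Rep (z2TwistOfTensor m) ((N : ℝ) * β) L /
        twistZ z2Rep (1 : Twist d (Multiplicative (ZMod 2))) ((N : ℝ) * β) L ≤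
      twistZ (fundamentalRep (Fin N)) (twistOfTensor N (halfTensor N m)) β L /
        twistZ (fundamentalRep (Fin N)) (1 : Twist d (Matrix.specialUnitaryGroup (Fin N) ℂ)) β L := by
  rw [twistOfTensor_halfTensor_eq_twistOfInvolution hN]
  exact twistZ_ratio_ge_centre (d := d) (L := L) (fundamentalRep (Fin N))
    (continuous_fundamentalRep (Fin N)) (fun g => (Matrix.mem_specialUnitaryGroup_iff.1 g.2).1)
    (negOneSU_mem_center hN) (negOneSU_mul_negOneSU hN) (by rw [fundamentalRep_apply]; rfl) hβ m

end SUNEven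

end Literature.MathematicalPhysics.QuantumFieldTheory
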